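import Literature.MathematicalPhysics.QuantumLattice.UrsellMomentRowLinear
import Mathlib.Analysis.Calculus.Deriv.Mul
import Mathlib.Analysis.Calculus.Deriv.Pow
import Mathlib.Analysis.Calculus.Deriv.Add
import Mathlib.Analysis.Calculus.Deriv.Comp
import Mathlib.Analysis.Calculus.Deriv.Prod
import Mathlib.Analysis.Calculus.FDeriv.Mul
import Mathlib.Analysis.Calculus.FDeriv.Prod
import Mathlib.Analysis.Calculus.FDeriv.RestrictScalars
import Mathlib.Algebra.BigOperators.Group.Finset.Powerset
import HarnessLib

/-!
# The derivative of the truncated expectation of determinant moments along a curve of propagators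

For the cluster map `c : F → ι`, the determinant moments `moment c G Q = det G|_{fields of Q}`
(`FermionicTreeExpansion`) and their Ursell (truncated) function `u_W(G) := ursellOf (moment c G) W`
(`UrsellInversion`), the file `UrsellMomentRowLinear` proved that `u_W` is LINEAR in each row of a
field of `W` and blind to the other rows. Here we draw the two consequences used to control the
dependence of the connected coefficients of a fermionic (single-scale) expansion on a one-body
parameter of the propagator (source field, chemical potential):

* the **multi-affine expansion** (algebraic, any commutative ring):
  `u_W(M + t E) = ∑_{T ⊆ fieldsOf c W} t^{#T} · u_W(M with the rows in T replaced by those of E)`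
  (`ursellOf_moment_add_smul_eq_sum`; the rows are replaced with `Finset.piecewise`);
* the **derivative formula** (over a nontrivially normed field `𝕜`): `u_W` is a differentiable
  function of the matrix (`differentiable_ursellOf`, `differentiable_moment`, a polynomial), its
  Fréchet derivative is `E ↦ ∑_{a ∈ fieldsOf c W} u_W(M with row a := E_a)`
  (`fderiv_ursellOf_moment_apply`), and hence along any curve of matrices `G(t)` with entrywise
  derivative `G'` at `t₀` (parameter in a subfield `𝕜₀`, e.g. a real source in complex matrices)
  `d/dt u_W(G(t))|_{t₀} = ∑_{a ∈ fieldsOf c W} u_W(G(t₀) with row a := G'_a)`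
  (`hasDerivAt_ursellOf_moment_comp`) — the Leibniz rule "differentiate one propagator line at a
  time" for truncated expectations.

Everything is PROVED; no definition and no named fact.

## References

* D. Ruelle, *Statistical Mechanics: Rigorous Results* (1969), §4.4.1 (4.5)–(4.7) (Ursell functions by
  Möbius inversion). [cite: Ruelle1969, §4.4.1 (4.5)-(4.7)]
* V. Mastropietro, *Non-Perturbative Renormalization* (2008), §2.8 (2.79) (determinant moments).
  [cite: Mastropietro2008, §2.8 (2.79)]
-/

noncomputable section

open Finset Literature.Probability.LatticeModels

namespace Literature.MathematicalPhysics.QuantumLattice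

namespace FermionicTree

/-! ### Algebra: dependence on rows, multi-affine expansion -/

section Algebra

variable {ι : Type*} [DecidableEq ι] {F : Type*} [Fintype F] [LinearOrder F] {R : Type*} [CommRing R]
variable (c : F → ι)

/-- The Ursell function of `W` only depends on the moments of the subsets of `W` (Möbius recursion).
[cite: Ruelle1969, §4.4.1 (4.5)-(4.7)] -/
theorem ursellOf_congr_of_subset {α : Type*} [DecidableEq α] {C : Type*} [CommRing C]
    (f g : Finset α → C) :
    ∀ (W : Finset α), (∀ P, P ⊆ W → f P = g P) → ursellOf f W = ursellOf g W := by
  intro W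
  induction W using Finset.strongInduction with
  | H W ih =>
    intro hfg
    rw [ursellOf_eq, ursellOf_eq, hfg W Subset.rfl]
    congr 1
    refine sum_congr rfl fun π hπ => prod_congr rfl fun P hP => ?_
    obtain ⟨hne, hπ'⟩ := mem_erase.1 hπ
    have hsp := mem_setPartitions.1 hπ'
    exact ih P (hsp.ssubset_of_ne_singleton hne hP) fun P' hP' => hfg P' fun x hx => hsp.subset hP (hP' hx)

/-- The moment of `Q` only depends on the rows of the fields of `Q`. [folklore] -/
theorem moment_eq_of_rows_eq (G G' : Matrix F F R) {Q : Finset ι} (h : ∀ a, c a ∈ Q → G' a = G a) :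
    moment c G' Q = moment c G Q := by
  unfold moment
  congr 1
  ext i j
  simp only [Matrix.submatrix_apply]
  rw [h _ (c_enum_mem c Q i)]

/-- **The Ursell function of `W` only depends on the rows of the fields of `W`.** [folklore] -/
theorem ursellOf_moment_eq_of_rows_eq (G G' : Matrix F F R) {W : Finset ι}
    (h : ∀ a, c a ∈ W → G' a = G a) :
    ursellOf (moment c G') W = ursellOf (moment c G) W :=
  ursellOf_congr_of_subset _ _ W fun _ hP => moment_eq_of_rows_eq c G G' fun a ha => h a (hP ha)

omit [Fintype F] [CommRing R] in
/-- Row replacement: `updateRow` is `Function.update` of the rows. [folklore] -/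
theorem updateRow_eq_update (X : Matrix F F R) (a : F) (v : F → R) :
    X.updateRow a v = Function.update X a v := rfl

omit [Fintype F] [CommRing R] in
/-- Replacing the rows in `insert a S` = replacing those in `S`, then row `a`. [folklore] -/
theorem piecewise_insert_eq_updateRow (S : Finset F) (N M : Matrix F F R) (a : F) :
    ((insert a S).piecewise N M : Matrix F F R) = Matrix.updateRow (S.piecewise N M) a (N a) := by
  rw [updateRow_eq_update]
  exact Finset.piecewise_insert (f := N) (g := M) S a

omit [Fintype F] [CommRing R] in
/-- Replacing a row outside `S` commutes with replacing the rows in `S`. [folklore] -/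
theorem piecewise_updateRow_of_not_mem {S : Finset F} {a : F} (ha : a ∉ S) (N M : Matrix F F R)
    (v : F → R) :
    Matrix.updateRow (S.piecewise N M) a v = (S.piecewise N (M.updateRow a v) : Matrix F F R) := by
  rw [updateRow_eq_update, updateRow_eq_update]
  exact Finset.update_piecewise_of_notMem (f := N) (g := M) S ha v

omit [Fintype F] [CommRing R] in
/-- `S.piecewise N (M with row a := N a) = (insert a S).piecewise N M` for `a ∉ S`. [folklore] -/
theorem piecewise_updateRow_self_of_not_mem {S : Finset F} {a : F} (ha : a ∉ S) (N M : Matrix F F R) :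
    (S.piecewise N (M.updateRow a (N a)) : Matrix F F R) = ((insert a S).piecewise N M : Matrix F F R) := by
  rw [piecewise_insert_eq_updateRow S N M a, piecewise_updateRow_of_not_mem ha N M (N a)]

omit [Fintype F] [CommRing R] in
/-- The bookkeeping identity of the multi-affine expansion: for `a ∉ S` and `T ⊆ S`,
replacing row `a` of the base by `N₂ a` is the same as adding `a` to the `N₂`-block `T`
(and, harmlessly, to `S`). [folklore] -/
theorem piecewise_piecewise_updateRow_of_not_mem {S T : Finset F} {a : F} (ha : a ∉ S) (hT : T ⊆ S)
    (N₁ N₂ M : Matrix F F R) :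
    (T.piecewise N₂ (S.piecewise N₁ (M.updateRow a (N₂ a)) : Matrix F F R) : Matrix F F R) =
      ((insert a T).piecewise N₂ ((insert a S).piecewise N₁ M : Matrix F F R) : Matrix F F R) := by
  have haT : a ∉ T := fun h => ha (hT h)
  ext i j
  by_cases hi : i = a
  · subst hi
    simp [Finset.piecewise, haT, ha]
  · have hiT : (i ∈ insert a T) ↔ i ∈ T := by simp [Finset.mem_insert, hi]
    have hiS : (i ∈ insert a S) ↔ i ∈ S := by simp [Finset.mem_insert, hi]
    simp [Finset.piecewise, hiT, hiS, Matrix.updateRow_ne hi]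

/-- **Multi-affinity of the Ursell function in a set of rows of fields of `W`**: replacing the rows
in `S` by those of `N₁ + N₂` gives the sum over `T ⊆ S` of the values with the rows in `T` from `N₂`
and those in `S ∖ T` from `N₁` (iterated row-additivity, `ursellOf_moment_updateRow_add`).
[cite: Ruelle1969, §4.4.1 (4.5)-(4.7)] -/
theorem ursellOf_moment_piecewise_add (N₁ N₂ : Matrix F F R) {W : Finset ι} :
    ∀ (S : Finset F) (M : Matrix F F R), (∀ a ∈ S, c a ∈ W) →
      ursellOf (moment c (S.piecewise (N₁ + N₂) M : Matrix F F R)) W =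
        ∑ T ∈ S.powerset,
          ursellOf (moment c (T.piecewise N₂ (S.piecewise N₁ M : Matrix F F R) : Matrix F F R)) W := by
  intro S
  induction S using Finset.induction_on with
  | empty =>
    intro M _
    simp only [Finset.piecewise_empty, Finset.powerset_empty, sum_singleton]
  | insert a S haS ih =>
    intro M hS
    have ha : c a ∈ W := hS a (mem_insert_self a S)
    have hS' : ∀ b ∈ S, c b ∈ W := fun b hb => hS b (mem_insert_of_mem hb)
    rw [piecewise_insert_eq_updateRow S (N₁ + N₂) M a, sum_powerset_insert haS,
      show (N₁ + N₂) a = N₁ a + N₂ a from rfl, ursellOf_moment_updateRow_add c _ (N₁ a) (N₂ a) W ha,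
      piecewise_updateRow_of_not_mem haS (N₁ + N₂) M (N₁ a),
      piecewise_updateRow_of_not_mem haS (N₁ + N₂) M (N₂ a), ih _ hS', ih _ hS']
    congr 1
    · refine sum_congr rfl fun T _ => ?_
      rw [piecewise_updateRow_self_of_not_mem haS N₁ M]
    · refine sum_congr rfl fun T hT => ?_
      rw [piecewise_piecewise_updateRow_of_not_mem haS (mem_powerset.1 hT) N₁ N₂ M]

/-- **Homogeneity of the Ursell function in a set of rows of fields of `W`**: scaling the replacing
rows by `s` scales the value by `s ^ #T` (iterated `ursellOf_moment_updateRow_smul`).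
[cite: Ruelle1969, §4.4.1 (4.5)-(4.7)] -/
theorem ursellOf_moment_piecewise_smul (N : Matrix F F R) (s : R) {W : Finset ι} :
    ∀ (T : Finset F) (M : Matrix F F R), (∀ a ∈ T, c a ∈ W) →
      ursellOf (moment c (T.piecewise (s • N) M : Matrix F F R)) W =
        s ^ T.card * ursellOf (moment c (T.piecewise N M : Matrix F F R)) W := by
  intro T
  induction T using Finset.induction_on with
  | empty =>
    intro M _
    simp only [Finset.piecewise_empty, card_empty, pow_zero, one_mul]
  | insert a T haT ih =>
    intro M hT
    have ha : c a ∈ W := hT a (mem_insert_self a T)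
    have hT' : ∀ b ∈ T, c b ∈ W := fun b hb => hT b (mem_insert_of_mem hb)
    rw [piecewise_insert_eq_updateRow T (s • N) M a, show (s • N) a = s • N a from rfl,
      ursellOf_moment_updateRow_smul c _ s (N a) W ha, piecewise_updateRow_of_not_mem haT (s • N) M (N a),
      ih _ hT', piecewise_updateRow_self_of_not_mem haT N M, card_insert_of_notMem haT, pow_succ]
    ring

/-- **The multi-affine expansion**: for matrices `M, E` and a scalar `t`,
`𝓔ᵀ_W(M + t E) = ∑_{T ⊆ fieldsOf c W} t^{#T} · 𝓔ᵀ_W(M with the rows in T replaced by those of E)`.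
The `T = ∅` term is `𝓔ᵀ_W(M)`, the `#T = 1` terms give the derivative. [cite: Ruelle1969, §4.4.1 (4.5)-(4.7)] -/
theorem ursellOf_moment_add_smul_eq_sum (M E : Matrix F F R) (t : R) (W : Finset ι) :
    ursellOf (moment c (M + t • E)) W =
      ∑ T ∈ (fieldsOf c W).powerset,
        t ^ T.card * ursellOf (moment c (T.piecewise E M : Matrix F F R)) W := by
  have hS : ∀ a ∈ fieldsOf c W, c a ∈ W := fun a ha => (mem_fieldsOf c).1 ha
  have h1 : ursellOf (moment c (M + t • E)) W =
      ursellOf (moment c ((fieldsOf c W).piecewise (M + t • E) M : Matrix F F R)) W := by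
    refine (ursellOf_moment_eq_of_rows_eq c (M + t • E) _ fun a ha => ?_).symm
    exact Finset.piecewise_eq_of_mem _ _ _ ((mem_fieldsOf c).2 ha)
  rw [h1, ursellOf_moment_piecewise_add c M (t • E) _ M hS]
  refine sum_congr rfl fun T hT => ?_
  rw [Finset.piecewise_same,
    ursellOf_moment_piecewise_smul c E t T M fun a ha => hS a (mem_powerset.1 hT ha)]

omit [Fintype F] [CommRing R] in
/-- The `#T = 1` terms of the multi-affine expansion: `{a}.piecewise E M = M with row a := E a`.
[folklore] -/
theorem piecewise_singleton_eq_updateRow (E M : Matrix F F R) (a : F) :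
    (({a} : Finset F).piecewise E M : Matrix F F R) = M.updateRow a (E a) := by
  rw [updateRow_eq_update]
  exact Finset.piecewise_singleton (f := E) (g := M) a

end Algebra

/-! ### Analysis: differentiability and the derivative formula -/

section Analysis

variable {ι : Type*} [DecidableEq ι] {F : Type*} [Fintype F] [LinearOrder F]
variable {𝕜 : Type*} [NontriviallyNormedField 𝕜]
variable (c : F → ι)

/-- An entry is a differentiable (indeed linear) function of the matrix. [folklore] -/
theorem differentiable_entry {m n : Type*} [Fintype m] [Fintype n] (a : m) (b : n) :
    Differentiable 𝕜 fun M : m → n → 𝕜 => M a b :=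
  (differentiable_apply (𝕜 := 𝕜) (F' := fun _ : n => 𝕜) b).comp
    (differentiable_apply (𝕜 := 𝕜) (F' := fun _ : m => n → 𝕜) a)

/-- **The determinant is a differentiable function of the entries** (a polynomial: the Leibniz
expansion is a finite sum of finite products of entries). [folklore] -/
theorem differentiable_det_of {n : Type*} [Fintype n] [DecidableEq n] :
    Differentiable 𝕜 fun M : n → n → 𝕜 => (Matrix.of M).det := by
  have h : (fun M : n → n → 𝕜 => (Matrix.of M).det) =
      fun M => ∑ σ : Equiv.Perm n, ((Equiv.Perm.sign σ : ℤ) : 𝕜) * ∏ i, M (σ i) i := by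
    funext M
    exact Matrix.det_apply' _
  rw [h]
  refine Differentiable.fun_sum fun σ _ => ?_
  refine Differentiable.const_mul (fun M => ?_) _
  exact (HasFDerivAt.finsetProd fun i _ => ((differentiable_entry (σ i) i) M).hasFDerivAt).differentiableAt

/-- **The moments are differentiable functions of the matrix.** [folklore] -/
theorem differentiable_moment (Q : Finset ι) :
    Differentiable 𝕜 fun M : F → F → 𝕜 => moment c (Matrix.of M) Q := by
  have h : (fun M : F → F → 𝕜 => moment c (Matrix.of M) Q) =
      (fun N : Fin (fieldsOf c Q).card → Fin (fieldsOf c Q).card → 𝕜 => (Matrix.of N).det) ∘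
        fun M k l => M (enum c Q k) (enum c Q l) := rfl
  rw [h]
  exact differentiable_det_of.comp
    (differentiable_pi.2 fun k => differentiable_pi.2 fun l => differentiable_entry _ _)

/-- **Ursell functions of differentiable moments are differentiable** (finite Möbius recursion).
[cite: Ruelle1969, §4.4.1 (4.5)-(4.7)] -/
theorem differentiable_ursellOf {X : Type*} [NormedAddCommGroup X] [NormedSpace 𝕜 X] {α : Type*}
    [DecidableEq α] (m : X → Finset α → 𝕜) (hm : ∀ P, Differentiable 𝕜 fun x => m x P) (V : Finset α) :
    Differentiable 𝕜 fun x => ursellOf (m x) V := by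
  induction V using Finset.strongInduction with
  | H V ih =>
    have hfun : (fun x => ursellOf (m x) V) = fun x =>
        m x V - ∑ π ∈ (setPartitions V).erase {V}, ∏ P ∈ π, ursellOf (m x) P := by
      funext x
      exact ursellOf_eq (m x) V
    rw [hfun]
    refine (hm V).sub (Differentiable.fun_sum fun π hπ => fun x => ?_)
    refine (HasFDerivAt.finsetProd (g := fun P x => ursellOf (m x) P)
      (g' := fun P => fderiv 𝕜 (fun x => ursellOf (m x) P) x) fun P hP => ?_).differentiableAt
    obtain ⟨hne, hπ'⟩ := mem_erase.1 hπ
    exact ((ih P ((mem_setPartitions.1 hπ').ssubset_of_ne_singleton hne hP)) x).hasFDerivAt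

/-- **The Ursell function of the determinant moments is a differentiable function of the
propagator matrix.** [cite: Ruelle1969, §4.4.1 (4.5)-(4.7)] -/
theorem differentiable_ursellOf_moment (W : Finset ι) :
    Differentiable 𝕜 fun M : F → F → 𝕜 => ursellOf (moment c (Matrix.of M)) W :=
  differentiable_ursellOf (fun M P => moment c (Matrix.of M) P) (fun P => differentiable_moment c P) W

/-- Its Fréchet derivative exists at every matrix. [folklore] -/
theorem hasFDerivAt_ursellOf_moment (M : F → F → 𝕜) (W : Finset ι) :
    HasFDerivAt (fun N : F → F → 𝕜 => ursellOf (moment c (Matrix.of N)) W)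
      (fderiv 𝕜 (fun N : F → F → 𝕜 => ursellOf (moment c (Matrix.of N)) W) M) M :=
  ((differentiable_ursellOf_moment c W) M).hasFDerivAt

omit [Fintype F] [LinearOrder F] in
/-- The `#T = 1` part of a sum over the power set: with weights `#T · 0 ^ (#T - 1)` (the derivative
of `t ^ #T` at `t = 0`) only the singletons survive. [folklore] -/
theorem sum_powerset_card_mul_zero_pow {β : Type*} (S : Finset β) (f : Finset β → 𝕜) :
    ∑ T ∈ S.powerset, (T.card : 𝕜) * (0 : 𝕜) ^ (T.card - 1) * f T = ∑ a ∈ S, f {a} := by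
  have key : ∀ T ∈ S.powerset,
      (T.card : 𝕜) * (0 : 𝕜) ^ (T.card - 1) * f T = if T.card = 1 then f T else 0 := by
    intro T _
    split_ifs with h1
    · rw [h1]
      simp
    · rcases Nat.lt_or_gt_of_ne h1 with h0 | h2
      · have h00 : T.card = 0 := by omega
        rw [h00]
        simp
      · have hne : T.card - 1 ≠ 0 := by omega
        rw [zero_pow hne]
        simp
  rw [sum_congr rfl key, ← sum_filter, ← Finset.powersetCard_eq_filter, Finset.powersetCard_one,
    sum_map]
  rfl

/-- **The directional derivative**: `d/dt 𝓔ᵀ_W(M + t E)|_{t=0} = ∑_{a ∈ fieldsOf c W} 𝓔ᵀ_W(M with row a := E a)`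
(the `#T = 1` terms of the multi-affine expansion). [cite: Ruelle1969, §4.4.1 (4.5)-(4.7)] -/
theorem hasDerivAt_ursellOf_moment_add_smul (M E : Matrix F F 𝕜) (W : Finset ι) :
    HasDerivAt (fun t : 𝕜 => ursellOf (moment c (M + t • E)) W)
      (∑ a ∈ fieldsOf c W, ursellOf (moment c (M.updateRow a (E a))) W) 0 := by
  have hfun : (fun t : 𝕜 => ursellOf (moment c (M + t • E)) W) = fun t =>
      ∑ T ∈ (fieldsOf c W).powerset,
        t ^ T.card * ursellOf (moment c (T.piecewise E M : Matrix F F 𝕜)) W := by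
    funext t
    exact ursellOf_moment_add_smul_eq_sum c M E t W
  rw [hfun]
  have hd : HasDerivAt (fun t : 𝕜 => ∑ T ∈ (fieldsOf c W).powerset,
      t ^ T.card * ursellOf (moment c (T.piecewise E M : Matrix F F 𝕜)) W)
      (∑ T ∈ (fieldsOf c W).powerset, (T.card : 𝕜) * (0 : 𝕜) ^ (T.card - 1) *
        ursellOf (moment c (T.piecewise E M : Matrix F F 𝕜)) W) 0 :=
    HasDerivAt.fun_sum fun T _ => (hasDerivAt_pow T.card (0 : 𝕜)).mul_const _
  rw [sum_powerset_card_mul_zero_pow] at hd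
  simpa only [piecewise_singleton_eq_updateRow] using hd

/-- **The derivative formula**: the Fréchet derivative of `M ↦ 𝓔ᵀ_W(M)` at `M` in the direction `E`
is `∑_{a ∈ fieldsOf c W} 𝓔ᵀ_W(M with row a := E a)`. [cite: Ruelle1969, §4.4.1 (4.5)-(4.7)] -/
theorem fderiv_ursellOf_moment_apply (M E : F → F → 𝕜) (W : Finset ι) :
    fderiv 𝕜 (fun N : F → F → 𝕜 => ursellOf (moment c (Matrix.of N)) W) M E =
      ∑ a ∈ fieldsOf c W, ursellOf (moment c ((Matrix.of M).updateRow a (E a))) W := by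
  have hγ : HasDerivAt (fun t : 𝕜 => M + t • E) E 0 := by
    simpa using ((hasDerivAt_id (0 : 𝕜)).smul_const E).const_add M
  have h2 : HasDerivAt (fun t : 𝕜 => ursellOf (moment c (Matrix.of (M + t • E))) W)
      (fderiv 𝕜 (fun N : F → F → 𝕜 => ursellOf (moment c (Matrix.of N)) W) M E) 0 :=
    (hasFDerivAt_ursellOf_moment c M W).comp_hasDerivAt_of_eq (0 : 𝕜) hγ (by simp)
  exact h2.unique (hasDerivAt_ursellOf_moment_add_smul c (Matrix.of M) (Matrix.of E) W)

/-- **The derivative of the truncated expectation along a curve of propagator matrices**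
("differentiate one line at a time"): if every entry of `t ↦ G t` has derivative `G' i j` at `t₀`
(the parameter `t` ranging over a normed subfield `𝕜₀` of the coefficient field `𝕜`, e.g. a real
source strength in complex propagators), then
`d/dt 𝓔ᵀ_W(G t)|_{t₀} = ∑_{a ∈ fieldsOf c W} 𝓔ᵀ_W(G t₀ with row a := G' a)`.
[cite: Ruelle1969, §4.4.1 (4.5)-(4.7)] -/
theorem hasDerivAt_ursellOf_moment_comp {𝕜₀ : Type*} [NontriviallyNormedField 𝕜₀] [NormedAlgebra 𝕜₀ 𝕜]
    {G : 𝕜₀ → F → F → 𝕜} {G' : F → F → 𝕜} {t₀ : 𝕜₀}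
    (hG : ∀ i j, HasDerivAt (fun t => G t i j) (G' i j) t₀) (W : Finset ι) :
    HasDerivAt (fun t => ursellOf (moment c (Matrix.of (G t))) W)
      (∑ a ∈ fieldsOf c W, ursellOf (moment c ((Matrix.of (G t₀)).updateRow a (G' a))) W) t₀ := by
  have hG' : HasDerivAt G G' t₀ := hasDerivAt_pi.2 fun i => hasDerivAt_pi.2 fun j => hG i j
  have h := ((hasFDerivAt_ursellOf_moment c (G t₀) W).restrictScalars 𝕜₀).comp_hasDerivAt t₀ hG'
  rw [ContinuousLinearMap.coe_restrictScalars', fderiv_ursellOf_moment_apply] at h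
  exact h

end Analysis

end FermionicTree

end Literature.MathematicalPhysics.QuantumLattice
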